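import Literature.Analysis.ODE.ComplexSecondOrder
import Mathlib.MeasureTheory.Integral.IntegralEqImproper
import HarnessLib

/-!
# The two-potential Wronskian identity for `y'' = Q y` and its consequences for matching problems

Topic `Literature/Analysis/ODE` (namespace `Literature.Analysis.ODE`), continuing
`ComplexSecondOrder.lean` (`IsSol2 Q y y' s`, `wronskian`). If `y` solves `y'' = Q₁ y` and `z`
solves `z'' = Q₂ z` on `s` (`𝕜 = ℝ` or `ℂ`), then the Wronskian `W = y z' − y' z` satisfies
**`W' = (Q₂ − Q₁) y z`** (`hasDerivAt_wronskian₂`; for `Q₁ = Q₂` this is the constancy of the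
Wronskian). Consequences used in eigenvalue perturbation / matching arguments (the variation of a
Wronskian of solutions depending on a parameter is an integral of the variation of the potential
against the product of the solutions — Hartman, Ch. XI §4 (Green's-function form of the variation
of constants); Shlapentokh-Rothman, CMP 329 (2014), Lemma 4.5): the fundamental-theorem form on a
compact interval (`wronskian_sub_eq_integral`), the improper form on `[a, ∞)` when `W → 0` at
infinity (`wronskian_eq_neg_integral_Ioi`), the vanishing of `W` at infinity for exponentially
decaying pairs (`tendsto_wronskian_zero_of_decay`), and the bilinear expansion of a Wronskian of
perturbed pairs (`wronskian_expand`). Everything is proved.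

## References

* P. Hartman, *Ordinary Differential Equations*, SIAM 2002, Ch. IV §8, Ch. XI §4. Key `Hartman2002`.
* Y. Shlapentokh-Rothman, Comm. Math. Phys. 329 (2014) 859–891, §4.3 Lemma 4.5.
  Key `ShlapentokhRothman2014KleinGordon`.
-/

noncomputable section

open Set Filter MeasureTheory
open scoped Topology

namespace Literature.Analysis.ODE

variable {𝕜 : Type*} [RCLike 𝕜]

variable {Q₁ Q₂ : ℝ → 𝕜} {y y' z z' : ℝ → 𝕜} {s : Set ℝ}

/-- **The two-potential Wronskian identity**: along a solution `y` of `y'' = Q₁ y` and a solution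
`z` of `z'' = Q₂ z`, `(y z' − y' z)' = (Q₂ − Q₁) y z`. [cite: Hartman2002, Ch. XI §4] -/
theorem hasDerivAt_wronskian₂ (hy : IsSol2 Q₁ y y' s) (hz : IsSol2 Q₂ z z' s) {t : ℝ} (ht : t ∈ s) :
    HasDerivAt (wronskian y y' z z') ((Q₂ t - Q₁ t) * y t * z t) t := by
  have h := ((hy.hasDerivAt t ht).mul (hz.hasDerivAt_deriv t ht)).sub ((hy.hasDerivAt_deriv t ht).mul (hz.hasDerivAt t ht))
  exact h.congr_deriv (by ring)

/-- The Wronskian of two solution pairs is continuous on `s`. [folklore] -/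
theorem continuousOn_wronskian (hy : IsSol2 Q₁ y y' s) (hz : IsSol2 Q₂ z z' s) : ContinuousOn (wronskian y y' z z') s :=
  fun _ ht ↦ (hasDerivAt_wronskian₂ hy hz ht).continuousAt.continuousWithinAt

/-- **Fundamental-theorem form**: `W(b) − W(a) = ∫_a^b (Q₂ − Q₁) y z` when `[a, b] ⊆ s` and the
potentials are continuous on `s`. [cite: Hartman2002, Ch. XI §4] -/
theorem wronskian_sub_eq_integral (hy : IsSol2 Q₁ y y' s) (hz : IsSol2 Q₂ z z' s) (hQ₁ : ContinuousOn Q₁ s) (hQ₂ : ContinuousOn Q₂ s)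
    {a b : ℝ} (hab : a ≤ b) (hsub : Icc a b ⊆ s) :
    wronskian y y' z z' b - wronskian y y' z z' a = ∫ t in a..b, (Q₂ t - Q₁ t) * y t * z t := by
  have hcont : ContinuousOn (fun t ↦ (Q₂ t - Q₁ t) * y t * z t) (Icc a b) :=
    (((hQ₂.mono hsub).sub (hQ₁.mono hsub)).mul (hy.continuousOn.1.mono hsub)).mul (hz.continuousOn.1.mono hsub)
  rw [intervalIntegral.integral_eq_sub_of_hasDerivAt (fun t ht ↦ hasDerivAt_wronskian₂ hy hz (hsub (by rwa [uIcc_of_le hab] at ht)))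
    (hcont.intervalIntegrable_of_Icc hab)]

/-- **Improper form on `[a, ∞)`**: if `(a − δ, ∞) ⊆ s`… precisely: if `Ici a ⊆ s`, `s` is a
neighbourhood of `a`, the integrand `(Q₂ − Q₁) y z` is integrable on `(a, ∞)` and `W → 0` at
infinity, then `W(a) = −∫_{(a, ∞)} (Q₂ − Q₁) y z`. [cite: Hartman2002, Ch. XI §4] -/
theorem wronskian_eq_neg_integral_Ioi (hy : IsSol2 Q₁ y y' s) (hz : IsSol2 Q₂ z z' s) {a : ℝ} (hsub : Ici a ⊆ s)
    (hint : IntegrableOn (fun t ↦ (Q₂ t - Q₁ t) * y t * z t) (Ioi a)) (hlim : Tendsto (wronskian y y' z z') atTop (𝓝 0)) :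
    wronskian y y' z z' a = -∫ t in Ioi a, (Q₂ t - Q₁ t) * y t * z t := by
  have h := integral_Ioi_of_hasDerivAt_of_tendsto' (fun t ht ↦ hasDerivAt_wronskian₂ hy hz (hsub ht)) hint hlim
  rw [h]; simp

/-- **Exponentially decaying pairs have `W → 0` at infinity.** If `‖y‖, ‖y'‖ ≤ C e^{−κ t}` and
`‖z‖, ‖z'‖ ≤ C' e^{−κ' t}` for large `t` with `κ + κ' > 0`, then `W(y, z)(t) → 0`. [folklore] -/
theorem tendsto_wronskian_zero_of_decay {C C' κ κ' T : ℝ} (hκ : 0 < κ + κ')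
    (hy : ∀ t, T ≤ t → ‖y t‖ ≤ C * Real.exp (-(κ * t)) ∧ ‖y' t‖ ≤ C * Real.exp (-(κ * t)))
    (hz : ∀ t, T ≤ t → ‖z t‖ ≤ C' * Real.exp (-(κ' * t)) ∧ ‖z' t‖ ≤ C' * Real.exp (-(κ' * t))) :
    Tendsto (wronskian y y' z z') atTop (𝓝 0) := by
  have hb : ∀ᶠ t in atTop, ‖wronskian y y' z z' t‖ ≤ 2 * (|C| * |C'|) * Real.exp (-((κ + κ') * t)) := by
    filter_upwards [eventually_ge_atTop T] with t ht
    obtain ⟨h1, h2⟩ := hy t ht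
    obtain ⟨h3, h4⟩ := hz t ht
    have hC : C * Real.exp (-(κ * t)) ≤ |C| * Real.exp (-(κ * t)) := mul_le_mul_of_nonneg_right (le_abs_self C) (Real.exp_pos _).le
    have hC' : C' * Real.exp (-(κ' * t)) ≤ |C'| * Real.exp (-(κ' * t)) := mul_le_mul_of_nonneg_right (le_abs_self C') (Real.exp_pos _).le
    have e : Real.exp (-(κ * t)) * Real.exp (-(κ' * t)) = Real.exp (-((κ + κ') * t)) := by
      rw [← Real.exp_add]; congr 1; ring
    unfold wronskian
    have hA : 0 ≤ |C| * Real.exp (-(κ * t)) := mul_nonneg (abs_nonneg _) (Real.exp_pos _).le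
    have hB : 0 ≤ |C'| * Real.exp (-(κ' * t)) := mul_nonneg (abs_nonneg _) (Real.exp_pos _).le
    calc ‖y t * z' t - y' t * z t‖ ≤ ‖y t‖ * ‖z' t‖ + ‖y' t‖ * ‖z t‖ := by
          refine (norm_sub_le _ _).trans ?_; rw [norm_mul, norm_mul]
      _ ≤ |C| * Real.exp (-(κ * t)) * (|C'| * Real.exp (-(κ' * t))) + |C| * Real.exp (-(κ * t)) * (|C'| * Real.exp (-(κ' * t))) :=
          add_le_add (mul_le_mul (h1.trans hC) (h4.trans hC') (norm_nonneg _) hA)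
            (mul_le_mul (h2.trans hC) (h3.trans hC') (norm_nonneg _) hA)
      _ = 2 * (|C| * |C'|) * Real.exp (-((κ + κ') * t)) := by rw [← e]; ring
  have hlim : Tendsto (fun t ↦ 2 * (|C| * |C'|) * Real.exp (-((κ + κ') * t))) atTop (𝓝 0) := by
    have : Tendsto (fun t ↦ Real.exp (-((κ + κ') * t))) atTop (𝓝 0) := by
      have h1 : Tendsto (fun t : ℝ ↦ -((κ + κ') * t)) atTop atBot :=
        tendsto_neg_atTop_atBot.comp (tendsto_id.const_mul_atTop hκ)
      exact Real.tendsto_exp_atBot.comp h1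
    simpa using this.const_mul (2 * (|C| * |C'|))
  exact squeeze_zero_norm' hb hlim

/-- **Bilinear expansion of a Wronskian of perturbed pairs**:
`W(y₁, z₁) = W(y₀, z₀) + W(y₁ − y₀, z₀) + W(y₀, z₁ − z₀) + W(y₁ − y₀, z₁ − z₀)` (pointwise). [folklore] -/
theorem wronskian_expand (y₀ y₀' z₀ z₀' y₁ y₁' z₁ z₁' : ℝ → 𝕜) (t : ℝ) :
    wronskian y₁ y₁' z₁ z₁' t = wronskian y₀ y₀' z₀ z₀' t + wronskian (y₁ - y₀) (y₁' - y₀') z₀ z₀' t +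
      wronskian y₀ y₀' (z₁ - z₀) (z₁' - z₀') t + wronskian (y₁ - y₀) (y₁' - y₀') (z₁ - z₀) (z₁' - z₀') t := by
  simp only [wronskian, Pi.sub_apply]; ring

/-- Scaling of the Wronskian in the second pair. [folklore] -/
theorem wronskian_smul_right (y y' z z' : ℝ → 𝕜) (c : 𝕜) (t : ℝ) :
    wronskian y y' (fun s ↦ c * z s) (fun s ↦ c * z' s) t = c * wronskian y y' z z' t := by
  unfold wronskian; ring

/-- Scaling of the Wronskian in the first pair. [folklore] -/
theorem wronskian_smul_left (y y' z z' : ℝ → 𝕜) (c : 𝕜) (t : ℝ) :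
    wronskian (fun s ↦ c * y s) (fun s ↦ c * y' s) z z' t = c * wronskian y y' z z' t := by
  unfold wronskian; ring

end Literature.Analysis.ODE

end
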